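import Literature.AlgebraicGeometry.AbelianSchemes.PolarizedTupleIsoLettersAdmissible
import Literature.AlgebraicGeometry.AbelianSchemes.TupleIsoConditionsLocus
import Literature.AlgebraicGeometry.AbelianSchemes.PolarizationUnitHypothesis
import Literature.AlgebraicGeometry.Motives.HilbertSchemeOverBaseFiniteType
import Literature.AlgebraicGeometry.Morphisms.HomSchemeClosedLayer
import Literature.AlgebraicGeometry.Morphisms.RefinedValuativeCriterionDense
import HarnessLib

/-!
# The `Isom`-PIECE of two polarized PEL tuples with prescribed graph letters: a quasi-compact finite-type `Y`-scheme whose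
# geometric points are the tuple-isomorphisms with letters `(Q, Q′)`

Topic `Literature/AlgebraicGeometry/AbelianSchemes`; namespace `Literature.AlgebraicGeometry.AbelianSchemes.AbelianSchemeOver`.  THEOREMS
ONLY (no definition, no named fact, no instance, no notation, no `sorry`).  Cell `hodgecm-mathlib` (D-0151), P6 «MOD programme» (crux hLiu418 =
stmt-HodgeConjecture-24832), SPREAD door, SP3-a2 LINE `Cruxes/HLiu418/Lines/F0_P6a_IsomSchemeFiniteType.lean` ED. 1: this file is the CLOSER
**(O-D)** of its socket `stub_ICON` — the statement `exists_isomPiece_of_letters` is the stub with the line's three `def`s (`TupleIsoVia`,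
`GraphLetters`, `prodEmb`) UNFOLDED, so that the line's ED. 2 closes the socket by name.  Division of labour (cell bus 2026-09-01): (T2) ★
`TupleIsoPointCriteria` and (O-C) ★ `TupleIsoConditionsLocus` by A-p13 (g37); (Ia)(Ib)(Ic)(Id), PRODEMB, (O-D) by A-p14 (g34).  HC_CM is proved
only modulo the 2 remaining named inputs (hLiu418, h413) until rung 0 closes; this file is generic and count-neutral.

## The mathematics ([MumfordFogartyKirwan1994] Ch. 0 §5 (c), Ch. 7 §2 proof of Prop. 7.3 ∕ Thm. 7.9; [Kottwitz1992] §5 p. 390)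

Let `Y` be a Noetherian scheme and `(𝒜ᵢ, ιᵢ, (Âᵢ, 𝒫ᵢ), λᵢ, lvlᵢ)` (`i = 1, 2`) two PEL tuples over `Y` (abelian scheme with `𝒪`-action,
dual pair, polarisation, level-`N` structure), with `Y`-closed embeddings `jᵢ : 𝒜ᵢ ↪ 𝐏ⁿ_Y` (`n ≥ 1`), and let `Q, Q′ ∈ ℚ[X]`.  There is a
`Y`-scheme `I → Y`, QUASI-COMPACT and LOCALLY OF FINITE TYPE, whose `Ω`-points over `t : Spec Ω → Y` (`Ω` algebraically closed) are
exactly: «there is an isomorphism of tuples `G : 𝒜₁,t ⥲ 𝒜₂,t` (the five clauses of the cell's `TupleIsoVia`) whose graph, embedded by the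
Segre product embedding `jW₁₂ = Segre ∘ (j₁ × j₂) : 𝒜₁ ×_Y 𝒜₂ ↪ 𝐏^{n²+2n}_Y`, has the cohomology-and-base-change letters `Q`, and whose
inverse has (through `jW₂₁`) the letters `Q′`».  ROAD (equality-loci route):
1. If `Q` or `Q′` is not ADMISSIBLE (`⌊Q(e)⌋ = Q(e)` beyond Mumford's bound) no tuple-isomorphism has these letters (★
   `floor_eval_eq_of_exists_tupleIso_letters`): `I := ∅`.
2. Otherwise the Hom-scheme PIECES `(M, m, u)` of `Hom_Y(𝒜₁, 𝒜₂)` with letters `Q` and `(M′, m′, u′)` of `Hom_Y(𝒜₂, 𝒜₁)` with letters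
   `Q′` exist, quasi-compact of finite type over `Y` (★ `Morphisms.exists_homSchemePiece_of_layers_quasiCompact` over the three ★ layers,
   fed with the Segre product embedding ★ `Morphisms/SegreProductEmbedding`).
3. Over the REDUCED PAIR BASE `B := (M ×_Y M′)_red → Y` (`π`) the two universal morphisms restrict to `U : 𝒜₁,B → 𝒜₂,B`,
   `V : 𝒜₂,B → 𝒜₁,B` (★ `Morphisms.exists_restrict_of_piece`), and the CONDITIONS LOCUS `I ↪ B` of ★ `exists_conditionsLocus` represents
   «`U_T` is an isomorphism of tuples with inverse `V_T`» (the polarisations over the reduced `B` supply the unit hypotheses, ★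
   `Polarization.nonempty_unitHatSlice_iso`).  `I → B → Y` is the piece.
4. POINTS.  (←) at `x : Spec Ω → B` through `I`, the conditions give an isomorphism `ε = U_x` of the ITERATED pull-backs exact on
   `λ` ∕ level ∕ action; ★ `exists_tupleRel_baseChange_comp_of_iso₂_explicit` turns it into the five clauses for the EXPLICIT
   `G = E₁ ≫ ε ≫ E₂⁻¹` between the SINGLE pull-backs along `x ≫ π`, ★ `comp_comparison_eq_of_classified` says `G` is classified by
   `x ≫ pr_M` (restriction is transitive), so ★ `Morphisms.graphLetters_of_classified` reads its letters `Q` off the piece; any inverse of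
   `G` is `E₂ ≫ V_x ≫ E₁⁻¹`, classified by `x ≫ pr_{M′}`, letters `Q′`.  (→) given `(G, Ĝ)` with letters at `t`, UNIVERSALITY of the two
   pieces classifies `G` and `G⁻¹` by `w₁ : Spec Ω → M`, `w₂ : Spec Ω → M′` over `t`, whence `x : Spec Ω → B` (`Spec Ω` is reduced);
   ★ `exists_iso₂_of_tupleRel_baseChange_comp` gives an isomorphism `ε` of the iterated pull-backs with `ε = E₁⁻¹ ≫ G ≫ E₂`, and
   `ε = U_x`, `ε⁻¹ = V_x` because both sides are classified by the same point (★ `Morphisms.eq_of_classified`): the conditions hold at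
   `x`, so `x` lifts to `I`.

* §1 `baseChangeComp_conj_left_comp_snd`, `baseChangeComp_conj_hom_comp_conj_inv`, `comp_eq_id_of_baseChangeComp_conj_comp_conj_eq_id` — bookkeeping for the conjugates
  `E₁ ≫ φ ≫ E₂⁻¹` by the transitivity isomorphisms ★ `baseChangeCompGrpIso`.
* §2 **`exists_isomPiece_of_letters`** — the piece (the cell's `stub_ICON`, unfolded).

## References
* [MumfordFogartyKirwan1994] D. Mumford, J. Fogarty, F. Kirwan, *Geometric Invariant Theory*, 3rd ed. (1994), Ch. 0 §5 (c) (p. 23); Ch. 7 §2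
  Definition 7.2–7.3 (pp. 129–130), Proposition 7.3 (p. 132), Theorem 7.9 (p. 138).
* [Kottwitz1992] R. Kottwitz, *Points on some Shimura varieties over finite fields*, JAMS 5 (1992), §5 (p. 390).
* [GortzWedhorn2020] U. Görtz, T. Wedhorn, *Algebraic Geometry I*, 2nd ed. (2020), Section (4.7) (pp. 107–108), Prop. 4.16.
* [Hartshorne1977] R. Hartshorne, *Algebraic Geometry* (1977), III Theorem 9.9 (p. 261).
-/

set_option autoImplicit false

noncomputable section

-- Mathlib's `Over`/pull-back API is stated across semireducible wrappers (as in the ★ `AbelianSchemes/*` files).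
set_option backward.isDefEq.respectTransparency false

universe u

open CategoryTheory CategoryTheory.Limits CategoryTheory.Abelian AlgebraicGeometry Polynomial MonoidalCategory
open Literature.AlgebraicGeometry Literature.AlgebraicGeometry.Morphisms
open Literature.AlgebraicGeometry.Modules Literature.AlgebraicGeometry.Modules.SerreTwist
open Literature.Algebra.Homology Literature.Algebra.Homology.LaurentCech Literature.Algebra.Homology.OrderedCech
open Literature.AlgebraicGeometry.AbelianSchemes Literature.AlgebraicGeometry.AbelianVarieties
open scoped MonObj CategoryTheory.Obj

namespace Literature.AlgebraicGeometry.AbelianSchemes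

namespace AbelianSchemeOver

/-! ### §1 Conjugates by the transitivity isomorphisms `Eᵢ : 𝒜ᵢ ×_Y T ≅ (𝒜ᵢ ×_Y B) ×_B T` -/

section Conj

variable {Y B T : Scheme.{u}} (𝒜₁ 𝒜₂ : AbelianSchemeOver Y) (π : B ⟶ Y) (x : T ⟶ B)

/-- `E₁ ≫ φ ≫ E₂⁻¹` lies over `T` for every `T`-morphism `φ` of the iterated pull-backs (★ `baseChangeCompGrpIso_hom_left_snd`,
`baseChangeCompGrpIso_inv_left_snd`). [cite: GortzWedhorn2020, Section (4.7) (pp. 107–108)] -/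
theorem baseChangeComp_conj_left_comp_snd (φ : ((𝒜₁.baseChange π).baseChange x).X ⟶ ((𝒜₂.baseChange π).baseChange x).X) :
    (((𝒜₁.baseChangeCompGrpIso π x).hom.hom.hom.left ≫ φ.left) ≫ (𝒜₂.baseChangeCompGrpIso π x).inv.hom.hom.left) ≫
        pullback.snd 𝒜₂.X.hom (x ≫ π) = pullback.snd 𝒜₁.X.hom (x ≫ π) := by
  have hφ : φ.left ≫ pullback.snd (pullback.snd 𝒜₂.X.hom π) x = pullback.snd (pullback.snd 𝒜₁.X.hom π) x := Over.w φ
  rw [Category.assoc, Category.assoc, baseChangeCompGrpIso_inv_left_snd, hφ, baseChangeCompGrpIso_hom_left_snd]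

/-- For an isomorphism `ε` of the iterated pull-backs, `E₂ ≫ ε⁻¹ ≫ E₁⁻¹` is a two-sided inverse of `E₁ ≫ ε ≫ E₂⁻¹`.
[cite: GortzWedhorn2020, Section (4.7) (pp. 107–108)] -/
theorem baseChangeComp_conj_hom_comp_conj_inv (ε : ((𝒜₁.baseChange π).baseChange x).X ≅ ((𝒜₂.baseChange π).baseChange x).X) :
    (((𝒜₁.baseChangeCompGrpIso π x).hom.hom.hom.left ≫ ε.hom.left) ≫ (𝒜₂.baseChangeCompGrpIso π x).inv.hom.hom.left) ≫
        (((𝒜₂.baseChangeCompGrpIso π x).hom.hom.hom.left ≫ ε.inv.left) ≫ (𝒜₁.baseChangeCompGrpIso π x).inv.hom.hom.left) = 𝟙 _ ∧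
      (((𝒜₂.baseChangeCompGrpIso π x).hom.hom.hom.left ≫ ε.inv.left) ≫ (𝒜₁.baseChangeCompGrpIso π x).inv.hom.hom.left) ≫
        (((𝒜₁.baseChangeCompGrpIso π x).hom.hom.hom.left ≫ ε.hom.left) ≫ (𝒜₂.baseChangeCompGrpIso π x).inv.hom.hom.left) = 𝟙 _ := by
  have h₁ : ε.hom.left ≫ ε.inv.left = 𝟙 _ := by rw [← Over.comp_left, Iso.hom_inv_id, Over.id_left]
  have h₂ : ε.inv.left ≫ ε.hom.left = 𝟙 _ := by rw [← Over.comp_left, Iso.inv_hom_id, Over.id_left]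
  constructor
  · simp only [Category.assoc]
    rw [baseChangeCompGrpIso_inv_left_hom_left_assoc, reassoc_of% h₁, baseChangeCompGrpIso_hom_left_inv_left]
  · simp only [Category.assoc]
    rw [baseChangeCompGrpIso_inv_left_hom_left_assoc, reassoc_of% h₂, baseChangeCompGrpIso_hom_left_inv_left]

/-- Cancelling the conjugation: if `(E₁ ≫ φ ≫ E₂⁻¹) ≫ (E₂ ≫ ψ ≫ E₁⁻¹) = 𝟙` then `φ ≫ ψ = 𝟙`. [cite: GortzWedhorn2020, Section (4.7) (pp. 107–108)] -/
theorem comp_eq_id_of_baseChangeComp_conj_comp_conj_eq_id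
    {φ : ((𝒜₁.baseChange π).baseChange x).X.left ⟶ ((𝒜₂.baseChange π).baseChange x).X.left}
    {ψ : ((𝒜₂.baseChange π).baseChange x).X.left ⟶ ((𝒜₁.baseChange π).baseChange x).X.left}
    (h : (((𝒜₁.baseChangeCompGrpIso π x).hom.hom.hom.left ≫ φ) ≫ (𝒜₂.baseChangeCompGrpIso π x).inv.hom.hom.left) ≫
        (((𝒜₂.baseChangeCompGrpIso π x).hom.hom.hom.left ≫ ψ) ≫ (𝒜₁.baseChangeCompGrpIso π x).inv.hom.hom.left) = 𝟙 _) :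
    φ ≫ ψ = 𝟙 _ := by
  simp only [Category.assoc] at h
  rw [baseChangeCompGrpIso_inv_left_hom_left_assoc] at h
  have h' := congrArg (fun χ => (𝒜₁.baseChangeCompGrpIso π x).inv.hom.hom.left ≫ χ ≫ (𝒜₁.baseChangeCompGrpIso π x).hom.hom.hom.left) h
  simpa only [Category.assoc, baseChangeCompGrpIso_inv_left_hom_left_assoc, baseChangeCompGrpIso_inv_left_hom_left, Category.comp_id,
    Category.id_comp] using h'

end Conj

/-! ### §2 The `Isom`-piece with prescribed letters -/

/-- **THE `Isom`-PIECE OF TWO POLARIZED PEL TUPLES WITH PRESCRIBED GRAPH LETTERS** (the cell's `stub_ICON` with `TupleIsoVia`,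
`GraphLetters`, `prodEmb` unfolded).  For two PEL tuples `(𝒜ᵢ, ιᵢ, (Âᵢ, 𝒫ᵢ), λᵢ, lvlᵢ)` over a Noetherian `Y`, `Y`-closed embeddings
`jᵢ : 𝒜ᵢ ↪ 𝐏ⁿ_Y` (`1 ≤ n`) and `Q, Q′ ∈ ℚ[X]`, there is `m : I → Y` QUASI-COMPACT and LOCALLY OF FINITE TYPE such that for every
algebraically closed field `Ω` and `t : Spec Ω → Y`: there is a tuple-isomorphism `(G, Ĝ)` of the fibre tuples at `t` (the five clauses
along `𝟙`) whose graph through the Segre product embedding `jW₁₂` has the letters `Q` and all of whose inverses have (through `jW₂₁`) the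
letters `Q′` — IFF `t` lifts to `I`.  ROAD: module docstring (empty piece for non-admissible `(Q, Q′)` by ★
`floor_eval_eq_of_exists_tupleIso_letters`; else the conditions locus ★ `exists_conditionsLocus` of the restricted universal morphisms over
the reduced pair base of the two Hom-scheme pieces ★ `Morphisms.exists_homSchemePiece_of_layers_quasiCompact`; points by ★
`exists_tupleRel_baseChange_comp_of_iso₂_explicit` ∕ `exists_iso₂_of_tupleRel_baseChange_comp`, ★ `comp_comparison_eq_of_classified`, ★
`Morphisms.graphLetters_of_classified`, ★ `Morphisms.eq_of_classified`).
[cite: MumfordFogartyKirwan1994, Ch. 0 §5 (c) (p. 23) and Ch. 7 §2 Proposition 7.3 (p. 132)] [cite: Kottwitz1992, §5 (p. 390)]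
[cite: GortzWedhorn2020, Section (4.7) (pp. 107–108)] -/
theorem exists_isomPiece_of_letters {O : Type} [CommRing O] {Y : Scheme.{0}} [IsNoetherian Y]
    (𝒜₁ : AbelianSchemeOver Y) (ρ₁ : 𝒜₁.RingAction O) (D₁ : 𝒜₁.DualPair) (pol₁ : 𝒜₁.Polarization D₁)
    {g N : ℕ} (lvl₁ : 𝒜₁.LevelStructure g N)
    (𝒜₂ : AbelianSchemeOver Y) (ρ₂ : 𝒜₂.RingAction O) (D₂ : 𝒜₂.DualPair) (pol₂ : 𝒜₂.Polarization D₂)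
    (lvl₂ : 𝒜₂.LevelStructure g N) {n : ℕ}
    (j₁ : 𝒜₁.X.left ⟶ Morphisms.projectiveSpace (Fin n) Y) (hj₁ : j₁ ≫ Morphisms.projectiveSpaceFst (Fin n) Y = 𝒜₁.X.hom)
    (j₂ : 𝒜₂.X.left ⟶ Morphisms.projectiveSpace (Fin n) Y) (hj₂ : j₂ ≫ Morphisms.projectiveSpaceFst (Fin n) Y = 𝒜₂.X.hom)
    (hn : 1 ≤ n) (hj₁c : IsClosedImmersion j₁) (hj₂c : IsClosedImmersion j₂) (Q Q' : ℚ[X]) :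
    ∃ (I : Scheme.{0}) (m : I ⟶ Y) (_ : QuasiCompact m) (_ : LocallyOfFiniteType m),
    ∀ ⦃Ω : Type⦄ [Field Ω] [IsAlgClosed Ω] (t : Spec (CommRingCat.of Ω) ⟶ Y),
      (∃ (G : (𝒜₁.baseChange t).X.left ⟶ (𝒜₂.baseChange t).X.left)
          (Ĝ : (D₁.baseChange t).hat.X.left ⟶ (D₂.baseChange t).hat.X.left),
          ((lvl₁.baseChange t).IsBaseChangeVia (lvl₂.baseChange t) (𝟙 _) G ∧
            (D₁.baseChange t).hat.IsBaseChangeVia (D₂.baseChange t).hat (𝟙 _) Ĝ ∧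
            (∃ (wG : (𝒜₁.baseChange t).X.hom ≫ 𝟙 _ = G ≫ (𝒜₂.baseChange t).X.hom)
                (wĜ : (D₁.baseChange t).hat.X.hom ≫ 𝟙 _ = Ĝ ≫ (D₂.baseChange t).hat.X.hom),
              Nonempty ((Scheme.Modules.pullback
                  (pullback.map (𝒜₁.baseChange t).X.hom (D₁.baseChange t).hat.X.hom
                    (𝒜₂.baseChange t).X.hom (D₂.baseChange t).hat.X.hom G Ĝ (𝟙 _) wG wĜ)).obj (D₂.baseChange t).P ≅
                (D₁.baseChange t).P)) ∧
            (pol₁.baseChange t).lam.left ≫ Ĝ = G ≫ (pol₂.baseChange t).lam.left ∧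
            ∀ a : O, (AbelianSchemeOver.baseChangeHom (ρ₁.i a) t).left ≫ G =
              G ≫ (AbelianSchemeOver.baseChangeHom (ρ₂.i a) t).left) ∧
          (∀ (hw : pullback.fst 𝒜₁.X.hom t ≫ 𝒜₁.X.hom = (G ≫ pullback.fst 𝒜₂.X.hom t) ≫ 𝒜₂.X.hom)
              (iΓ : pullback 𝒜₁.X.hom t ⟶ Morphisms.projectiveSpace (Fin (n * n + n + n)) (Spec (CommRingCat.of Ω))),
              iΓ ≫ Morphisms.projectiveSpaceFst (Fin (n * n + n + n)) (Spec (CommRingCat.of Ω)) = pullback.snd 𝒜₁.X.hom t →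
              iΓ ≫ Morphisms.projectiveSpaceMap (Fin (n * n + n + n)) t =
                pullback.lift (pullback.fst 𝒜₁.X.hom t) (G ≫ pullback.fst 𝒜₂.X.hom t) hw ≫
                  (MonoidalCategoryStruct.tensorHom
                (Over.homMk j₁ hj₁ : 𝒜₁.X ⟶ Over.mk (Morphisms.projectiveSpaceFst (Fin n) Y))
                (Over.homMk j₂ hj₂ : 𝒜₂.X ⟶ Over.mk (Morphisms.projectiveSpaceFst (Fin n) Y)) ≫
              Morphisms.segreOver Y (Morphisms.segreIndexEquivFin n n)).left →
              ∀ ⦃K : Type⦄ [Field K] ⦃X' : Scheme.{0}⦄ (k : X' ⟶ pullback 𝒜₁.X.hom t) (f₀ : X' ⟶ Spec (CommRingCat.of K))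
                (x : Spec (CommRingCat.of K) ⟶ (Spec (CommRingCat.of Ω))),
                IsPullback k f₀ (iΓ ≫ Morphisms.projectiveSpaceFst (Fin (n * n + n + n)) (Spec (CommRingCat.of Ω))) x →
                ∀ e : ℕ, regularityBound (preHilbertPoly ℚ (Nat.card (Fin (n * n + n + n))) 0) 0
                    (preHilbertPoly ℚ (Nat.card (Fin (n * n + n + n))) 0 - Q) - 1 ≤ (e : ℤ) →
                  Subsingleton (CategoryTheory.Abelian.Ext.{1} (unitModule X') ((Scheme.Modules.pullback k).obj
                    (twistMod (iΓ ≫ pullback.snd (terminal.from (Spec (CommRingCat.of Ω))) (terminal.from (Morphisms.projectiveSpaceInt (Fin (n * n + n + n)))))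
                      (unitModule _) e)) 1) ∧
                  ((Module.finrank Γ(Spec (CommRingCat.of K), ⊤) (SecMod ((Scheme.Modules.pullback k).obj
                    (twistMod (iΓ ≫ pullback.snd (terminal.from (Spec (CommRingCat.of Ω))) (terminal.from (Morphisms.projectiveSpaceInt (Fin (n * n + n + n)))))
                      (unitModule _) e)) f₀.appTop.hom ⊤) : ℕ) : ℚ) = (Q).eval (e : ℚ)) ∧
          ∀ Ginv : (𝒜₂.baseChange t).X.left ⟶ (𝒜₁.baseChange t).X.left, Ginv ≫ G = 𝟙 _ → G ≫ Ginv = 𝟙 _ →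
            (∀ (hw : pullback.fst 𝒜₂.X.hom t ≫ 𝒜₂.X.hom = (Ginv ≫ pullback.fst 𝒜₁.X.hom t) ≫ 𝒜₁.X.hom)
              (iΓ : pullback 𝒜₂.X.hom t ⟶ Morphisms.projectiveSpace (Fin (n * n + n + n)) (Spec (CommRingCat.of Ω))),
              iΓ ≫ Morphisms.projectiveSpaceFst (Fin (n * n + n + n)) (Spec (CommRingCat.of Ω)) = pullback.snd 𝒜₂.X.hom t →
              iΓ ≫ Morphisms.projectiveSpaceMap (Fin (n * n + n + n)) t =
                pullback.lift (pullback.fst 𝒜₂.X.hom t) (Ginv ≫ pullback.fst 𝒜₁.X.hom t) hw ≫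
                  (MonoidalCategoryStruct.tensorHom
                (Over.homMk j₂ hj₂ : 𝒜₂.X ⟶ Over.mk (Morphisms.projectiveSpaceFst (Fin n) Y))
                (Over.homMk j₁ hj₁ : 𝒜₁.X ⟶ Over.mk (Morphisms.projectiveSpaceFst (Fin n) Y)) ≫
              Morphisms.segreOver Y (Morphisms.segreIndexEquivFin n n)).left →
              ∀ ⦃K : Type⦄ [Field K] ⦃X' : Scheme.{0}⦄ (k : X' ⟶ pullback 𝒜₂.X.hom t) (f₀ : X' ⟶ Spec (CommRingCat.of K))
                (x : Spec (CommRingCat.of K) ⟶ (Spec (CommRingCat.of Ω))),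
                IsPullback k f₀ (iΓ ≫ Morphisms.projectiveSpaceFst (Fin (n * n + n + n)) (Spec (CommRingCat.of Ω))) x →
                ∀ e : ℕ, regularityBound (preHilbertPoly ℚ (Nat.card (Fin (n * n + n + n))) 0) 0
                    (preHilbertPoly ℚ (Nat.card (Fin (n * n + n + n))) 0 - Q') - 1 ≤ (e : ℤ) →
                  Subsingleton (CategoryTheory.Abelian.Ext.{1} (unitModule X') ((Scheme.Modules.pullback k).obj
                    (twistMod (iΓ ≫ pullback.snd (terminal.from (Spec (CommRingCat.of Ω))) (terminal.from (Morphisms.projectiveSpaceInt (Fin (n * n + n + n)))))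
                      (unitModule _) e)) 1) ∧
                  ((Module.finrank Γ(Spec (CommRingCat.of K), ⊤) (SecMod ((Scheme.Modules.pullback k).obj
                    (twistMod (iΓ ≫ pullback.snd (terminal.from (Spec (CommRingCat.of Ω))) (terminal.from (Morphisms.projectiveSpaceInt (Fin (n * n + n + n)))))
                      (unitModule _) e)) f₀.appTop.hom ⊤) : ℕ) : ℚ) = (Q').eval (e : ℚ))) ↔
      ∃ s : Spec (CommRingCat.of Ω) ⟶ I, s ≫ m = t := by
  classical
  haveI := hj₁c
  haveI := hj₂c
  haveI hjW₁₂c := Morphisms.isClosedImmersion_prodEmb 𝒜₁.X 𝒜₂.X j₁ hj₁ j₂ hj₂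
  haveI hjW₂₁c := Morphisms.isClosedImmersion_prodEmb 𝒜₂.X 𝒜₁.X j₂ hj₂ j₁ hj₁
  have hjW₁₂ := Morphisms.prodEmb_comp_projectiveSpaceFst 𝒜₁.X 𝒜₂.X j₁ hj₁ j₂ hj₂
  have hjW₂₁ := Morphisms.prodEmb_comp_projectiveSpaceFst 𝒜₂.X 𝒜₁.X j₂ hj₂ j₁ hj₁
  have hq := Morphisms.isProjective_of_isClosedImmersion_projectiveSpace_fin j₁ hj₁
  have hp := Morphisms.isProjective_of_isClosedImmersion_projectiveSpace_fin j₂ hj₂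
  have hn' : 1 ≤ Nat.card (Fin (n * n + n + n)) := Morphisms.one_le_natCard_fin_segre hn
  haveI : Smooth 𝒜₁.X.hom := 𝒜₁.isSmooth
  haveI : Flat 𝒜₁.X.hom := inferInstance
  haveI : Smooth 𝒜₂.X.hom := 𝒜₂.isSmooth
  haveI : Flat 𝒜₂.X.hom := inferInstance
  -- 1. ADMISSIBILITY of `(Q, Q′)`; otherwise the piece is EMPTY
  by_cases hadm :
    (∀ e : ℕ, regularityBound (preHilbertPoly ℚ (Nat.card (Fin (n * n + n + n))) 0) 0
        (preHilbertPoly ℚ (Nat.card (Fin (n * n + n + n))) 0 - Q) - 1 ≤ (e : ℤ) → ((⌊Q.eval (e : ℚ)⌋₊ : ℕ) : ℚ) = Q.eval (e : ℚ)) ∧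
    (∀ e : ℕ, regularityBound (preHilbertPoly ℚ (Nat.card (Fin (n * n + n + n))) 0) 0
        (preHilbertPoly ℚ (Nat.card (Fin (n * n + n + n))) 0 - Q') - 1 ≤ (e : ℤ) → ((⌊Q'.eval (e : ℚ)⌋₊ : ℕ) : ℚ) = Q'.eval (e : ℚ))
  swap
  · refine ⟨(⊥ : Y.Opens), (⊥ : Y.Opens).ι, inferInstance, inferInstance, fun Ω _ _ t => ⟨fun h => ?_, ?_⟩⟩
    · exact (hadm (floor_eval_eq_of_exists_tupleIso_letters 𝒜₁ ρ₁ D₁ pol₁ lvl₁ 𝒜₂ ρ₂ D₂ pol₂ lvl₂ j₁ hj₁ j₂ hj₂ Q Q' t h)).elim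
    · rintro ⟨s, -⟩
      exact (TopologicalSpace.Opens.mem_bot.mp (s (IsLocalRing.closedPoint Ω)).2).elim
  -- 2. the two Hom-scheme PIECES with letters `Q` (for `Hom(𝒜₁, 𝒜₂)`) and `Q′` (for `Hom(𝒜₂, 𝒜₁)`)
  obtain ⟨M, m, hMn, hMs, hMl, hMq, u, hu, hself, huniv⟩ :=
    Morphisms.exists_homSchemePiece_of_layers_quasiCompact Motives.exists_hilbertScheme_over_letters_quasiCompact
      Morphisms.exists_idealSheafData_homSchemeClosedLayer Morphisms.openLayer_of_isoLocus_hB3 𝒜₁.X.hom 𝒜₂.X.hom hq hp hn' _ hjW₁₂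
      Q hadm.1
  obtain ⟨M', m', hMn', hMs', hMl', hMq', u', hu', hself', huniv'⟩ :=
    Morphisms.exists_homSchemePiece_of_layers_quasiCompact Motives.exists_hilbertScheme_over_letters_quasiCompact
      Morphisms.exists_idealSheafData_homSchemeClosedLayer Morphisms.openLayer_of_isoLocus_hB3 𝒜₂.X.hom 𝒜₁.X.hom hp hq hn' _ hjW₂₁
      Q' hadm.2
  haveI := hMn; haveI := hMs; haveI := hMl; haveI := hMq; haveI := hMn'; haveI := hMs'; haveI := hMl'; haveI := hMq'
  -- 3. the REDUCED PAIR BASE `B = (M ×_Y M′)_red`, `π : B → Y`, `w₁ : B → M`, `w₂ : B → M′`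
  haveI : CompactSpace ↥(pullback m m') := QuasiCompact.compactSpace_of_compactSpace (pullback.fst m m' ≫ m)
  obtain ⟨B, ιB, hιB, hBred, hBfac⟩ : ∃ (B : Scheme.{0}) (ιB : B ⟶ pullback m m') (_ : IsClosedImmersion ιB) (_ : IsReduced B),
      ∀ ⦃T : Scheme.{0}⦄ [IsReduced T] (s₀ : T ⟶ pullback m m'), ∃ s : T ⟶ B, s ≫ ιB = s₀ :=
    ⟨_, (pullback m m').nilradical.subschemeι, inferInstance, inferInstance, fun T _ s₀ =>
      ⟨IsClosedImmersion.lift (pullback m m').nilradical.subschemeι s₀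
          (by rw [Scheme.IdealSheafData.ker_subschemeι]; exact Morphisms.nilradical_le_ker s₀),
        IsClosedImmersion.lift_fac _ _ _⟩⟩
  haveI : IsLocallyNoetherian B := LocallyOfFiniteType.isLocallyNoetherian ιB
  haveI : CompactSpace ↥B := QuasiCompact.compactSpace_of_compactSpace ιB
  haveI : IsNoetherian B := {}
  obtain ⟨w₁, hw₁def⟩ : ∃ w₁ : B ⟶ M, ιB ≫ pullback.fst m m' = w₁ := ⟨_, rfl⟩
  obtain ⟨w₂, hw₂def⟩ : ∃ w₂ : B ⟶ M', ιB ≫ pullback.snd m m' = w₂ := ⟨_, rfl⟩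
  obtain ⟨π, hπdef⟩ : ∃ π : B ⟶ Y, w₁ ≫ m = π := ⟨_, rfl⟩
  have hw₁ : w₁ ≫ m = π := hπdef
  have hw₂ : w₂ ≫ m' = π := by rw [← hπdef, ← hw₁def, ← hw₂def, Category.assoc, Category.assoc, pullback.condition]
  haveI : QuasiCompact π := by rw [← hπdef, ← hw₁def]; infer_instance
  haveI : LocallyOfFiniteType π := by rw [← hπdef, ← hw₁def]; infer_instance
  -- the restrictions `U : 𝒜₁,B → 𝒜₂,B` of `u` and `V : 𝒜₂,B → 𝒜₁,B` of `u′`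
  obtain ⟨U₀, hU₀, hUcl⟩ := Morphisms.exists_restrict_of_piece 𝒜₁.X.hom 𝒜₂.X.hom m u hu w₁ π hw₁
  obtain ⟨V₀, hV₀, hVcl⟩ := Morphisms.exists_restrict_of_piece 𝒜₂.X.hom 𝒜₁.X.hom m' u' hu' w₂ π hw₂
  let U : (𝒜₁.baseChange π).X ⟶ (𝒜₂.baseChange π).X := Over.homMk U₀ hU₀
  let V : (𝒜₂.baseChange π).X ⟶ (𝒜₁.baseChange π).X := Over.homMk V₀ hV₀
  have hUl : U.left ≫ pullback.map 𝒜₂.X.hom π 𝒜₂.X.hom m (𝟙 _) w₁ (𝟙 Y) (by simp) (by simpa using hw₁.symm) =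
      pullback.map 𝒜₁.X.hom π 𝒜₁.X.hom m (𝟙 _) w₁ (𝟙 Y) (by simp) (by simpa using hw₁.symm) ≫ u := hUcl
  have hVl : V.left ≫ pullback.map 𝒜₁.X.hom π 𝒜₁.X.hom m' (𝟙 _) w₂ (𝟙 Y) (by simp) (by simpa using hw₂.symm) =
      pullback.map 𝒜₂.X.hom π 𝒜₂.X.hom m' (𝟙 _) w₂ (𝟙 Y) (by simp) (by simpa using hw₂.symm) ≫ u' := hVcl
  -- 4. the CONDITIONS LOCUS over `B`
  haveI := (pol₁.baseChange π).isMonHom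
  haveI := (pol₂.baseChange π).isMonHom
  haveI : ∀ a, IsMonHom (baseChangeHom (ρ₁.i a) π) := fun a => by
    haveI := ρ₁.isMonHom a
    exact isMonHom_baseChangeHom (ρ₁.i a) π
  haveI : ∀ a, IsMonHom (baseChangeHom (ρ₂.i a) π) := fun a => by
    haveI := ρ₂.isMonHom a
    exact isMonHom_baseChangeHom (ρ₂.i a) π
  obtain ⟨I, mI, hIq, hIl, hI⟩ := exists_conditionsLocus (𝒜₁.baseChange π) (𝒜₂.baseChange π) (D₁.baseChange π) (D₂.baseChange π)
    (pol₁.baseChange π).nonempty_unitHatSlice_iso (pol₂.baseChange π).nonempty_unitHatSlice_iso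
    (pol₁.baseChange π).lam (pol₂.baseChange π).lam (lvl₁.baseChange π) (lvl₂.baseChange π)
    (fun a => baseChangeHom (ρ₁.i a) π) (fun a => baseChangeHom (ρ₂.i a) π) U V
  haveI := hIq; haveI := hIl
  refine ⟨I, mI ≫ π, inferInstance, inferInstance, fun Ω _ _ t => ⟨?_, ?_⟩⟩
  · -- (→) a tuple-isomorphism with letters at `t` gives a point of `I`
    rintro ⟨G, Ĝ, hvia, hletQ, hletQ'⟩
    have hvia' := hvia
    obtain ⟨⟨hX, -⟩, -, ⟨wG, -, -⟩, -, -⟩ := hvia'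
    have hGsnd : G ≫ pullback.snd 𝒜₂.X.hom t = pullback.snd 𝒜₁.X.hom t := by
      have w := wG
      change pullback.snd 𝒜₁.X.hom t ≫ 𝟙 _ = G ≫ pullback.snd 𝒜₂.X.hom t at w
      rw [Category.comp_id] at w
      exact w.symm
    haveI : IsIso G := isIso_of_isBaseChangeVia_id hX
    have hG'snd : inv G ≫ pullback.snd 𝒜₁.X.hom t = pullback.snd 𝒜₂.X.hom t := by rw [IsIso.inv_comp_eq, hGsnd]
    -- UNIVERSALITY of the two pieces: `G` is classified by `v₁`, `G⁻¹` by `v₂`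
    obtain ⟨v₁, ⟨hv₁, hcl₁⟩, -⟩ := huniv t G hGsnd hletQ
    obtain ⟨v₂, ⟨hv₂, hcl₂⟩, -⟩ := huniv' t (inv G) hG'snd (hletQ' (inv G) (IsIso.inv_hom_id G) (IsIso.hom_inv_id G))
    -- the point `x : Spec Ω → B` of the reduced pair base
    obtain ⟨s₀, hs₀₁, hs₀₂⟩ : ∃ s₀ : Spec (CommRingCat.of Ω) ⟶ pullback m m', s₀ ≫ pullback.fst m m' = v₁ ∧ s₀ ≫ pullback.snd m m' = v₂ :=
      ⟨pullback.lift v₁ v₂ (hv₁.trans hv₂.symm), pullback.lift_fst _ _ _, pullback.lift_snd _ _ _⟩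
    obtain ⟨x, hx⟩ := hBfac s₀
    have e₁ : x ≫ w₁ = v₁ := by rw [← hw₁def, ← Category.assoc, hx, hs₀₁]
    have e₂ : x ≫ w₂ = v₂ := by rw [← hw₂def, ← Category.assoc, hx, hs₀₂]
    have e₃ : x ≫ π = t := by rw [← hw₁, ← Category.assoc, e₁, hv₁]
    subst e₁ e₂ e₃
    -- the isomorphism of the ITERATED pull-backs
    obtain ⟨ε, hε, hεleft, hlam, hσ, hact⟩ :=
      exists_iso₂_of_tupleRel_baseChange_comp 𝒜₁ 𝒜₂ ρ₁ ρ₂ D₁ D₂ pol₁ pol₂ lvl₁ lvl₂ π x hvia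
    -- `G = E₁ ≫ U_x ≫ E₂⁻¹` and `G⁻¹ = E₂ ≫ V_x ≫ E₁⁻¹`: both sides are classified by the same point
    have hbrU := comp_comparison_eq_of_classified 𝒜₁ 𝒜₂ m u π w₁ hw₁ U x hUl
    have hbrV := comp_comparison_eq_of_classified 𝒜₂ 𝒜₁ m' u' π w₂ hw₂ V x hVl
    have hGeq : G = ((𝒜₁.baseChangeCompGrpIso π x).hom.hom.hom.left ≫ ((Over.pullback x).map U).left) ≫
        (𝒜₂.baseChangeCompGrpIso π x).inv.hom.hom.left :=
      Morphisms.eq_of_classified 𝒜₁.X.hom 𝒜₂.X.hom m u (x ≫ w₁) (x ≫ π) hv₁ _ _ hGsnd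
        (baseChangeComp_conj_left_comp_snd 𝒜₁ 𝒜₂ π x ((Over.pullback x).map U)) hcl₁ hbrU
    have hG'eq : inv G = ((𝒜₂.baseChangeCompGrpIso π x).hom.hom.hom.left ≫ ((Over.pullback x).map V).left) ≫
        (𝒜₁.baseChangeCompGrpIso π x).inv.hom.hom.left :=
      Morphisms.eq_of_classified 𝒜₂.X.hom 𝒜₁.X.hom m' u' (x ≫ w₂) (x ≫ π) hv₂ _ _ hG'snd
        (baseChangeComp_conj_left_comp_snd 𝒜₂ 𝒜₁ π x ((Over.pullback x).map V)) hcl₂ hbrV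
    have hUV : ((Over.pullback x).map U).left ≫ ((Over.pullback x).map V).left = 𝟙 _ :=
      comp_eq_id_of_baseChangeComp_conj_comp_conj_eq_id 𝒜₁ 𝒜₂ π x (by rw [← hGeq, ← hG'eq]; exact IsIso.hom_inv_id G)
    have hεU' : ε.hom.left = ((Over.pullback x).map U).left := by
      rw [hεleft, hGeq]
      simp only [Category.assoc]
      rw [baseChangeCompGrpIso_inv_left_hom_left_assoc, baseChangeCompGrpIso_inv_left_hom_left]
      exact Category.comp_id _
    have hεU : ε.hom = baseChangeHom U x := Over.OverMorphism.ext hεU'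
    have hεV : ε.inv = baseChangeHom V x := by
      refine Iso.inv_ext (Over.OverMorphism.ext ?_)
      rw [Over.comp_left, Over.id_left, hεU']
      exact hUV
    obtain ⟨l, hl⟩ := (hI x).mpr ⟨ε, hε, hεU, hεV, hlam, hσ, hact⟩
    exact ⟨l, by rw [← Category.assoc, hl]⟩
  · -- (←) a point of `I` over `t` gives a tuple-isomorphism with the letters
    rintro ⟨l, hl⟩
    obtain ⟨x, hxl, rfl⟩ : ∃ x : Spec (CommRingCat.of Ω) ⟶ B, l ≫ mI = x ∧ x ≫ π = t :=
      ⟨l ≫ mI, rfl, by simpa only [Category.assoc] using hl⟩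
    obtain ⟨ε, hε, hεU, hεV, hlam, hσ, hact⟩ := (hI x).mp ⟨l, hxl⟩
    haveI := hε
    obtain ⟨Ĝ, h5⟩ := exists_tupleRel_baseChange_comp_of_iso₂_explicit 𝒜₁ 𝒜₂ ρ₁ ρ₂ D₁ D₂ pol₁ pol₂ lvl₁ lvl₂ π x ε hlam hσ hact
    have hεU' : ((Over.pullback x).map U).left = ε.hom.left := by rw [hεU]
    have hεV' : ((Over.pullback x).map V).left = ε.inv.left := by rw [hεV]
    -- `G = E₁ ≫ ε ≫ E₂⁻¹` is classified by `x ≫ w₁`, its inverse `E₂ ≫ ε⁻¹ ≫ E₁⁻¹` by `x ≫ w₂`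
    have hbrU := comp_comparison_eq_of_classified 𝒜₁ 𝒜₂ m u π w₁ hw₁ U x hUl
    have hbrV := comp_comparison_eq_of_classified 𝒜₂ 𝒜₁ m' u' π w₂ hw₂ V x hVl
    rw [hεU'] at hbrU
    rw [hεV'] at hbrV
    refine ⟨_, Ĝ, h5, ?_, fun Ginv h₁ h₂ => ?_⟩
    · exact Morphisms.graphLetters_of_classified 𝒜₁.X.hom 𝒜₂.X.hom _ hjW₁₂ m u hu Q hself (x ≫ w₁) (x ≫ π)
        (by rw [Category.assoc, hw₁]) _ hbrU
    · have hinv := (baseChangeComp_conj_hom_comp_conj_inv 𝒜₁ 𝒜₂ π x ε).1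
      have hGinv : Ginv = ((𝒜₂.baseChangeCompGrpIso π x).hom.hom.hom.left ≫ ε.inv.left) ≫
          (𝒜₁.baseChangeCompGrpIso π x).inv.hom.hom.left := by
        calc Ginv = Ginv ≫ ((((𝒜₁.baseChangeCompGrpIso π x).hom.hom.hom.left ≫ ε.hom.left) ≫
                (𝒜₂.baseChangeCompGrpIso π x).inv.hom.hom.left) ≫
              (((𝒜₂.baseChangeCompGrpIso π x).hom.hom.hom.left ≫ ε.inv.left) ≫ (𝒜₁.baseChangeCompGrpIso π x).inv.hom.hom.left)) := by
              rw [hinv, Category.comp_id]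
          _ = _ := by rw [← Category.assoc, h₁, Category.id_comp]
      rw [hGinv]
      exact Morphisms.graphLetters_of_classified 𝒜₂.X.hom 𝒜₁.X.hom _ hjW₂₁ m' u' hu' Q' hself' (x ≫ w₂) (x ≫ π)
        (by rw [Category.assoc, hw₂]) _ hbrV

end AbelianSchemeOver

end Literature.AlgebraicGeometry.AbelianSchemes

end
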